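import Literature.AlgebraicGeometry.Resolution.EmbeddedResolution
import Literature.AlgebraicGeometry.Resolution.MarkedIdeals
import Literature.AlgebraicGeometry.Resolution.BlowupsExistence
import Literature.AlgebraicGeometry.Resolution.BlowupsProperProofs
import Literature.AlgebraicGeometry.Resolution.AlterationsProofs
import Mathlib.AlgebraicGeometry.Morphisms.OpenImmersion
import HarnessLib

/-!
# Sequences of blow-ups as data: multiple blow-ups (BGMW 2011, Defs. 3.1.3–3.1.4), restriction

Topic: `Literature/AlgebraicGeometry/Resolution`. DEFINITIONS (with unfolding API and the
structural lemmas proved) for the decomposition of the named fact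
`BierstoneGrigorievMilmanWlodarczyk2011_embedded` (`EmbeddedResolution.lean`; Bierstone–
Grigoriev–Milman–Włodarczyk 2011, Cor. 8.0.6) below its "centre form"
(`EmbeddedResolutionCentre.lean`): what is left there is the *canonical* resolution of marked
ideals and its functoriality under étale morphisms / open immersions (BGMW Thm. 8.0.5 (2): "the
induced sequence `(X'_i) = φ^*(X_i)` is an extension of the canonical resolution of
`φ^*(X, 𝓘, E, μ)`"), and functoriality is a statement about resolution SEQUENCES as objects —
their individual centres, truncations and pull-backs along open immersions — which the
`Prop`-valued inductive predicates `IsEmbeddedTransform` (`EmbeddedResolution.lean`) and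
`IsMultipleBlowup` (`MarkedIdeals.lean`) forget. This file provides the data-level notion and
links it to both predicates:

* `blowup J`, `blowup.π J : blowup J ⟶ X`, `blowup.isBlowup J` — a CHOSEN blowing up of `X`
  along `J` (existence: `exists_isBlowup`, `BlowupsExistence.lean`, GW Prop. 13.92);
  `blowup.map C j : blowup (j^*C) ⟶ blowup C` for an open immersion `j` (GW Prop. 13.91 (1)),
  `blowup.isPullback_map` (GW Prop. 13.91 (2): the square is cartesian),
  `blowup.isOpenImmersion_map`.
* `CentreSeq X` — **a multiple blow-up of `X` as data** (BGMW Def. 3.1.4: "a sequence of …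
  blow-ups `σ_i : X_{i-1} ← X_i` of smooth centers `C_{i-1} ⊂ X_{i-1}`"; here: any centres, the
  conditions being predicates): the dependent list of the successive centres
  `C_0 ⊆ X_0 = X`, `C_1 ⊆ X_1 = Bl_{C_0} X_0`, …; `length`, `top` (`X_r`), `comp`
  (`σ_1 ∘ ⋯ ∘ σ_r : X_r → X`), `AllRegular`, `CentresOver T`, `strictTransform Y` (iterated
  closure of the preimage off the centre, GW (13.19)), with `rfl`-simp lemmas;
  `isProper_comp` (blow-ups are proper, `stacks02NS_holds`).
* `IsEmbeddedTransform.precomp`, `CentreSeq.isEmbeddedTransform` — a `CentreSeq` with regular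
  centres over `T` is an embedded transform in the sense of `EmbeddedResolution.lean`.
* `CentreSeq.restrict s j`, `restrictι`, `isOpenImmersion_restrictι`, `restrict_comp`,
  `isPullback_restrict` — **restriction of a multiple blow-up along an open immersion**
  `j : U → X` (the induced sequence `φ^*(X_i)` of BGMW Thm. 8.0.5 for `φ = j`; GW
  Prop. 13.91 (1)–(2) iterated): centres pulled back, the comparison maps `(s|U)_i → X_i` open
  immersions making all squares cartesian; `AllRegular.restrict`, `CentresOver.restrict`,
  `restrict_strictTransform`.
* `CentreSeq.transformMarked`, `IsAdmissibleFor M`, `IsResolutionOf M` — the transforms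
  `(X_i, 𝓘_i, E_i, μ)` of a marked ideal along a sequence and conditions (1)–(2), (6) of BGMW
  Def. 3.1.3 (centres regular [printed: smooth], inside `supp(𝓘_i, μ)`, snc with `E_i`;
  `supp(𝓘_r, μ) = ∅`); `IsMultipleBlowup.precomp`, `IsAdmissibleFor.isMultipleBlowup`,
  `IsResolutionOf.isMarkedResolution` (link to `MarkedIdeals.lean`), `IsAdmissibleFor.allRegular`,
  `IsAdmissibleFor.centresOver` (centres of a resolution of `(X, 𝓘, E, μ)`, `μ ≥ 1`, lie over
  `V(𝓘)`: `C_i ⊆ supp(𝓘_i, μ) ⊆ V(𝓘_i) ⊆ σ⁻¹ V(𝓘)`, the controlled transform containing the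
  total transform), `MarkedIdeal.support_subset_support_ideal`.

Isomorphism steps ("morphisms which are either isomorphisms or blow-ups", Def. 3.1.4) are not
separate constructors: a blow-up along the unit ideal sheaf `⊤` (empty centre) is an
isomorphism (`IsBlowup.isIso`), which is how trivial steps arise under restriction
(`(⊤ : IdealSheafData).comap`); the equivalence "equal up to inserting trivial steps"
(extensions, Def. 3.1.5) is left to the file stating functoriality.

## Sources

* E. Bierstone, D. Grigoriev, P. Milman, J. Włodarczyk, *Effective Hironaka resolution and its
  complexity*, Asian J. Math. 15 (2011) 193–228 = arXiv:1206.3090, §3.1: Defs. 3.1.3, 3.1.4,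
  3.1.5 and Remark (1) after it (p. 6); Thm. 8.0.5 (p. 23). [BierstoneGrigorievMilmanWlodarczyk2011]
* U. Görtz, T. Wedhorn, *Algebraic Geometry I*, 2nd ed. (2020), (13.19): Def. 13.90,
  Prop. 13.91 (1)–(2), Prop. 13.92; strict transform (p. 414). [GortzWedhorn2020]

## Design notes

* `CentreSeq : Scheme.{u} → Type (u+1)` is an inductive family indexed by the base; `cons C rest`
  PREPENDS the first blow-up (the rest lives on `blowup C`), so recursion descends along the
  tower; the `Prop`-level predicates of the tree are generated by APPENDING a blow-up, whence
  the closure lemmas `IsEmbeddedTransform.precomp` / `IsMultipleBlowup.precomp`.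
* `top`/`comp` are recursive definitions: on constructors they unfold by `rfl`
  (`top_cons`, `comp_cons`, …) but not reducibly, so instance goals about `s.comp` are stated
  via `show` in the proofs below.
-/

noncomputable section

open CategoryTheory CategoryTheory.Limits AlgebraicGeometry TopologicalSpace Topology

namespace Literature.AlgebraicGeometry.Resolution

universe u

/-! ## A chosen blowing up -/

/-- A CHOSEN blowing up `Bl_J(X)` of `X` along the ideal sheaf `J` (it exists for every scheme
and every ideal sheaf, `exists_isBlowup`; Görtz–Wedhorn I, Prop. 13.92; unique up to unique
isomorphism, `IsBlowup.unique`). [cite: GortzWedhorn2020, Prop. 13.92] -/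
def blowup {X : Scheme.{u}} (J : X.IdealSheafData) : Scheme.{u} :=
  (exists_isBlowup X J).choose

/-- The structure morphism `π : Bl_J(X) → X` of the chosen blowing up.
[cite: GortzWedhorn2020, Def. 13.90] -/
def blowup.π {X : Scheme.{u}} (J : X.IdealSheafData) : blowup J ⟶ X :=
  (exists_isBlowup X J).choose_spec.choose

/-- The chosen blowing up is a blowing up of `X` along `J` (universal property, GW Def. 13.90).
[cite: GortzWedhorn2020, Prop. 13.92] -/
theorem blowup.isBlowup {X : Scheme.{u}} (J : X.IdealSheafData) : IsBlowup (blowup.π J) J :=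
  (exists_isBlowup X J).choose_spec.choose_spec

/-! ## Multiple blow-ups as data -/

/-- **A multiple blow-up of `X`, as data** (BGMW Def. 3.1.4 with Def. 3.1.3: "a sequence of
blow-ups `σ_i : X_i → X_{i-1}` of smooth centers `C_{i-1} ⊂ X_{i-1}`,
`X_0 = X ← X_1 ← ⋯ ← X_r`"; the smoothness/admissibility conditions are kept as predicates,
`AllRegular`, `IsAdmissibleFor`): the dependent list of the successive centres — an ideal sheaf
`C` on `X`, then a multiple blow-up of the chosen blowing up `blowup C = Bl_C(X)`.
[cite: BierstoneGrigorievMilmanWlodarczyk2011, Def. 3.1.4] -/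
inductive CentreSeq : Scheme.{u} → Type (u + 1)
  | nil (X : Scheme.{u}) : CentreSeq X
  | cons {X : Scheme.{u}} (C : X.IdealSheafData) (rest : CentreSeq (blowup C)) : CentreSeq X

namespace CentreSeq

/-- The number `r` of blow-ups in the sequence (its length, BGMW Def. 3.1.4).
[cite: BierstoneGrigorievMilmanWlodarczyk2011, Def. 3.1.4] -/
def length : {X : Scheme.{u}} → CentreSeq X → ℕ
  | _, nil _ => 0
  | _, cons _ rest => rest.length + 1

/-- The last scheme `X_r` of the multiple blow-up `X_r → ⋯ → X_0 = X`. [folklore] -/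
def top : {X : Scheme.{u}} → CentreSeq X → Scheme.{u}
  | X, nil _ => X
  | _, cons _ rest => rest.top

/-- The composite `σ_1 ∘ ⋯ ∘ σ_r : X_r → X` of the blow-ups. [folklore] -/
def comp : {X : Scheme.{u}} → (s : CentreSeq X) → (s.top ⟶ X)
  | X, nil _ => 𝟙 X
  | _, cons C rest => rest.comp ≫ blowup.π C

/-- All centres `V(C_i)` of the sequence are regular schemes (BGMW: smooth centres).
[cite: BierstoneGrigorievMilmanWlodarczyk2011, Def. 3.1.3] -/
def AllRegular : {X : Scheme.{u}} → CentreSeq X → Prop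
  | _, nil _ => True
  | _, cons C rest => Scheme.IsRegular C.subscheme ∧ rest.AllRegular

/-- All centres of the sequence lie over the subset `T ⊆ X` (as in `IsEmbeddedTransform`: BGMW
Thm. 2.0.2 (2) with `T = X ∖ Reg(Y)`). [folklore] -/
def CentresOver : {X : Scheme.{u}} → CentreSeq X → Set X → Prop
  | _, nil _, _ => True
  | _, cons C rest, T => (C.support : Set _) ⊆ T ∧ rest.CentresOver (blowup.π C ⁻¹' T)

/-- The iterated **strict transform** of a subset `Y ⊆ X` along the sequence: at each step the
closure of the preimage of `Y_i ∖ V(C_i)` (Görtz–Wedhorn I, (13.19), p. 414; as in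
`IsEmbeddedTransform`). [cite: GortzWedhorn2020, (13.19) p. 414] -/
def strictTransform : {X : Scheme.{u}} → (s : CentreSeq X) → Set X → Set s.top
  | _, nil _, Y => Y
  | _, cons C rest, Y => rest.strictTransform (closure (blowup.π C ⁻¹' (Y \ (C.support : Set _))))

/-- Unfolding. [folklore] -/
@[simp] theorem length_nil (X : Scheme.{u}) : (nil X).length = 0 := rfl
/-- Unfolding. [folklore] -/
@[simp] theorem length_cons {X : Scheme.{u}} (C : X.IdealSheafData) (rest : CentreSeq (blowup C)) :
    (cons C rest).length = rest.length + 1 := rfl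
/-- Unfolding. [folklore] -/
@[simp] theorem top_nil (X : Scheme.{u}) : (nil X).top = X := rfl
/-- Unfolding. [folklore] -/
@[simp] theorem top_cons {X : Scheme.{u}} (C : X.IdealSheafData) (rest : CentreSeq (blowup C)) :
    (cons C rest).top = rest.top := rfl
/-- Unfolding. [folklore] -/
@[simp] theorem comp_nil (X : Scheme.{u}) : (nil X).comp = 𝟙 X := rfl
/-- Unfolding. [folklore] -/
@[simp] theorem comp_cons {X : Scheme.{u}} (C : X.IdealSheafData) (rest : CentreSeq (blowup C)) :
    (cons C rest).comp = rest.comp ≫ blowup.π C := rfl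
/-- Unfolding. [folklore] -/
@[simp] theorem allRegular_nil (X : Scheme.{u}) : (nil X).AllRegular := trivial
/-- Unfolding. [folklore] -/
@[simp] theorem allRegular_cons {X : Scheme.{u}} (C : X.IdealSheafData)
    (rest : CentreSeq (blowup C)) :
    (cons C rest).AllRegular ↔ Scheme.IsRegular C.subscheme ∧ rest.AllRegular := Iff.rfl
/-- Unfolding. [folklore] -/
@[simp] theorem centresOver_nil (X : Scheme.{u}) (T : Set X) : (nil X).CentresOver T := trivial
/-- Unfolding. [folklore] -/
@[simp] theorem centresOver_cons {X : Scheme.{u}} (C : X.IdealSheafData)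
    (rest : CentreSeq (blowup C)) (T : Set X) :
    (cons C rest).CentresOver T ↔ (C.support : Set X) ⊆ T ∧ rest.CentresOver (blowup.π C ⁻¹' T) :=
  Iff.rfl
/-- Unfolding. [folklore] -/
@[simp] theorem strictTransform_nil (X : Scheme.{u}) (Y : Set X) :
    (nil X).strictTransform Y = Y := rfl
/-- Unfolding. [folklore] -/
@[simp] theorem strictTransform_cons {X : Scheme.{u}} (C : X.IdealSheafData)
    (rest : CentreSeq (blowup C)) (Y : Set X) : (cons C rest).strictTransform Y =
      rest.strictTransform (closure (blowup.π C ⁻¹' (Y \ (C.support : Set X)))) := rfl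


/-- The one-step sequence blowing up `C`. [folklore] -/
def single {X : Scheme.{u}} (C : X.IdealSheafData) : CentreSeq X :=
  cons C (nil _)

/-- Unfolding. [folklore] -/
@[simp] theorem top_single {X : Scheme.{u}} (C : X.IdealSheafData) : (single C).top = blowup C :=
  rfl

/-- Unfolding. [folklore] -/
@[simp] theorem comp_single {X : Scheme.{u}} (C : X.IdealSheafData) :
    (single C).comp = 𝟙 _ ≫ blowup.π C := rfl

/-- Unfolding. [folklore] -/
@[simp] theorem length_single {X : Scheme.{u}} (C : X.IdealSheafData) : (single C).length = 1 :=
  rfl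

/-- Unfolding. [folklore] -/
@[simp] theorem strictTransform_single {X : Scheme.{u}} (C : X.IdealSheafData) (Y : Set X) :
    (single C).strictTransform Y = closure (blowup.π C ⁻¹' (Y \ (C.support : Set X))) := rfl

/-- `CentresOver` is monotone in the set. [folklore] -/
theorem CentresOver.mono : ∀ {X : Scheme.{u}} (s : CentreSeq X) {T T' : Set X},
    T ⊆ T' → s.CentresOver T → s.CentresOver T'
  | _, nil _, _, _, _, _ => trivial
  | _, cons C rest, _, T', hTT', h => by
    obtain ⟨hC, hrest⟩ := h
    exact (centresOver_cons C rest T').mpr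
      ⟨hC.trans hTT', CentresOver.mono rest (Set.preimage_mono hTT') hrest⟩

/-- The composite of a multiple blow-up of a locally Noetherian scheme is proper (blow-ups of
locally Noetherian schemes are proper, `IsBlowup.isProper`; Stacks 02NS). [folklore] -/
theorem isProper_comp : ∀ {X : Scheme.{u}} [IsLocallyNoetherian X] (s : CentreSeq X),
    IsProper s.comp
  | X, _, nil _ => show IsProper (𝟙 X) from inferInstance
  | X, _, cons C rest => by
    haveI : IsProper (blowup.π C) := (blowup.isBlowup C).isProper
    haveI : IsLocallyNoetherian (blowup C) := LocallyOfFiniteType.isLocallyNoetherian (blowup.π C)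
    haveI := isProper_comp rest
    show IsProper (rest.comp ≫ blowup.π C)
    infer_instance

end CentreSeq

/-- Embedded transforms (`IsEmbeddedTransform`, generated by appending blow-ups) are closed under
PREPENDING a blow-up with regular centre over `T`: the strict transform of `Y` along `σ ∘ τ` is
that of `closure (τ⁻¹(Y ∖ V(C)))` along `σ`. [folklore] -/
theorem IsEmbeddedTransform.precomp {X X₁ : Scheme.{u}} {Y T : Set X} (C : X.IdealSheafData)
    (τ : X₁ ⟶ X) (hτ : IsBlowup τ C) (hC : Scheme.IsRegular C.subscheme)
    (hT : (C.support : Set X) ⊆ T) {X' : Scheme.{u}} {σ : X' ⟶ X₁} {Y' : Set X'}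
    (h : IsEmbeddedTransform (closure (τ ⁻¹' (Y \ (C.support : Set X)))) (τ ⁻¹' T) σ Y') :
    IsEmbeddedTransform Y T (σ ≫ τ) Y' := by
  induction h with
  | refl => simpa using IsEmbeddedTransform.single C τ hτ hC hT
  | @blowup X' X'' σ Y' h C' τ' hτ' hC' hT' ih =>
    have := IsEmbeddedTransform.blowup ih C' τ' hτ' hC' (by
      rintro _ ⟨x, hx, rfl⟩
      exact hT' ⟨x, hx, rfl⟩)
    simpa [Category.assoc] using this

namespace CentreSeq

/-- **A multiple blow-up with regular centres over `T` is an embedded transform** of every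
`Y ⊆ X`, with strict transform `s.strictTransform Y` (the data-level notion refines the predicate
of `EmbeddedResolution.lean`). [folklore] -/
theorem isEmbeddedTransform : ∀ {X : Scheme.{u}} (s : CentreSeq X) (Y T : Set X),
    s.AllRegular → s.CentresOver T → IsEmbeddedTransform Y T s.comp (s.strictTransform Y)
  | _, nil _, Y, T, _, _ => IsEmbeddedTransform.refl
  | _, cons C rest, Y, T, hreg, hover => by
    obtain ⟨hC, hreg⟩ := hreg
    obtain ⟨hCT, hover⟩ := hover
    exact IsEmbeddedTransform.precomp C (blowup.π C) (blowup.isBlowup C) hC hCT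
      (isEmbeddedTransform rest _ _ hreg hover)

end CentreSeq

/-! ## Restriction along an open immersion (GW Prop. 13.91 (1)–(2)) -/

section Restrict

variable {X U : Scheme.{u}}

/-- The morphism `Bl(j) : Bl_{j^*C}(U) → Bl_C(X)` over an open immersion `j : U → X` provided by
the universal property (Görtz–Wedhorn I, Prop. 13.91 (1), for the flat morphism `j`).
[cite: GortzWedhorn2020, Prop. 13.91 (1)] -/
def blowup.map (C : X.IdealSheafData) (j : U ⟶ X) [IsOpenImmersion j] :
    blowup (C.comap j) ⟶ blowup C :=
  (blowup.isBlowup C).lift (blowup.π (C.comap j) ≫ j)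
    (by
      rw [Scheme.IdealSheafData.comap_comp]
      exact (blowup.isBlowup (C.comap j)).isEffectiveCartier)

/-- `Bl(j)` lies over `j`: `Bl(j) ≫ π_X = π_U ≫ j`. [cite: GortzWedhorn2020, Prop. 13.91 (1)] -/
@[reassoc (attr := simp)]
theorem blowup.map_π (C : X.IdealSheafData) (j : U ⟶ X) [IsOpenImmersion j] :
    blowup.map C j ≫ blowup.π C = blowup.π (C.comap j) ≫ j :=
  (blowup.isBlowup C).lift_comp _ _

/-- **Görtz–Wedhorn I, Prop. 13.91 (2)** for an open immersion `j`: the square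
`(Bl(j), π_U, π_X, j)` is cartesian, `Bl_{j^*C}(U) = Bl_C(X) ×_X U`
(`IsBlowup.isPullback_of_isOpenImmersion`). [cite: GortzWedhorn2020, Prop. 13.91 (2)] -/
theorem blowup.isPullback_map (C : X.IdealSheafData) (j : U ⟶ X) [IsOpenImmersion j] :
    IsPullback (blowup.map C j) (blowup.π (C.comap j)) (blowup.π C) j :=
  (blowup.isBlowup C).isPullback_of_isOpenImmersion j (blowup.isBlowup (C.comap j))
    (blowup.map_π C j)

/-- `Bl(j)` is an open immersion for `j` an open immersion (base change). [folklore] -/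
instance blowup.isOpenImmersion_map (C : X.IdealSheafData) (j : U ⟶ X) [IsOpenImmersion j] :
    IsOpenImmersion (blowup.map C j) :=
  MorphismProperty.of_isPullback (blowup.isPullback_map C j).flip inferInstance

end Restrict

namespace CentreSeq

variable {X U : Scheme.{u}}

/-- **Restriction of a multiple blow-up along an open immersion** `j : U → X` (the induced
sequence `φ^*(X_i)` of BGMW Thm. 8.0.5 / Def. 3.1.5 Remark (1), for `φ = j`): blow up `U` along
`j^*C_0`, then restrict the rest along the open immersion `Bl(j) : Bl_{j^*C_0}(U) → Bl_{C_0}(X)`.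
[cite: BierstoneGrigorievMilmanWlodarczyk2011, Thm. 8.0.5 (2) and Def. 3.1.5 Remark (1)] -/
def restrict : {X U : Scheme.{u}} → CentreSeq X → (j : U ⟶ X) → [IsOpenImmersion j] → CentreSeq U
  | _, U, nil _, _, _ => nil U
  | _, _, cons C rest, j, _ => cons (C.comap j) (restrict rest (blowup.map C j))

/-- The comparison morphism `(s|U)_r → X_r` from the top of the restricted sequence (an open
immersion, `isOpenImmersion_restrictι`, exhibiting `(s|U)_r` as the preimage of `U`,
`isPullback_restrict`). [folklore] -/
def restrictι : {X U : Scheme.{u}} → (s : CentreSeq X) → (j : U ⟶ X) → [IsOpenImmersion j] →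
    ((s.restrict j).top ⟶ s.top)
  | _, _, nil _, j, _ => j
  | _, _, cons C rest, j, _ => restrictι rest (blowup.map C j)

/-- Unfolding. [folklore] -/
@[simp] theorem restrict_nil (X : Scheme.{u}) (j : U ⟶ X) [IsOpenImmersion j] :
    (nil X).restrict j = nil U := rfl
/-- Unfolding. [folklore] -/
@[simp] theorem restrict_cons (C : X.IdealSheafData) (rest : CentreSeq (blowup C)) (j : U ⟶ X)
    [IsOpenImmersion j] :
    (cons C rest).restrict j = cons (C.comap j) (rest.restrict (blowup.map C j)) := rfl

/-- The comparison morphism `(s|U)_r → X_r` is an open immersion. [folklore] -/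
theorem isOpenImmersion_restrictι : ∀ {X U : Scheme.{u}} (s : CentreSeq X) (j : U ⟶ X)
    [IsOpenImmersion j], IsOpenImmersion (s.restrictι j)
  | _, _, nil _, _, hj => hj
  | _, _, cons C rest, j, _ => isOpenImmersion_restrictι rest (blowup.map C j)

/-- The restricted sequence lies over the original one: `(s|U)_r → U → X = (s|U)_r → X_r → X`.
[folklore] -/
theorem restrict_comp : ∀ {X U : Scheme.{u}} (s : CentreSeq X) (j : U ⟶ X) [IsOpenImmersion j],
    (s.restrict j).comp ≫ j = s.restrictι j ≫ s.comp
  | X, U, nil _, j, _ => show 𝟙 U ≫ j = j ≫ 𝟙 X by simp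
  | _, _, cons C rest, j, _ => by
    show ((rest.restrict (blowup.map C j)).comp ≫ blowup.π (C.comap j)) ≫ j =
      restrictι rest (blowup.map C j) ≫ rest.comp ≫ blowup.π C
    rw [← reassoc_of% (restrict_comp rest (blowup.map C j)), blowup.map_π, Category.assoc]

/-- **The restricted sequence is the preimage of `U`**: the square `((s|U)_r → X_r, (s|U)_r → U,
X_r → X, U → X)` is cartesian (GW Prop. 13.91 (2) iterated, `IsPullback.paste_vert`).
[cite: GortzWedhorn2020, Prop. 13.91 (2)] -/
theorem isPullback_restrict : ∀ {X U : Scheme.{u}} (s : CentreSeq X) (j : U ⟶ X)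
    [IsOpenImmersion j], IsPullback (s.restrictι j) (s.restrict j).comp s.comp j
  | X, U, nil _, j, _ =>
    show IsPullback j (𝟙 U) (𝟙 X) j from IsPullback.of_vert_isIso ⟨by simp⟩
  | _, _, cons C rest, j, _ => by
    show IsPullback (restrictι rest (blowup.map C j))
      ((rest.restrict (blowup.map C j)).comp ≫ blowup.π (C.comap j)) (rest.comp ≫ blowup.π C) j
    exact (isPullback_restrict rest (blowup.map C j)).paste_vert (blowup.isPullback_map C j)

/-- Regular centres restrict to regular centres (`V(j^*C) = V(C) ×_X U` is open in `V(C)`).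
[folklore] -/
theorem AllRegular.restrict : ∀ {X U : Scheme.{u}} (s : CentreSeq X) (j : U ⟶ X)
    [IsOpenImmersion j], s.AllRegular → (s.restrict j).AllRegular
  | _, _, nil _, _, _, _ => trivial
  | _, U, cons C rest, j, _, h => by
    obtain ⟨hC, hrest⟩ := h
    refine (allRegular_cons (C.comap j) _).mpr ⟨?_, AllRegular.restrict rest _ hrest⟩
    exact (hC.of_isOpenImmersion (pullback.snd j C.subschemeι)).of_iso (C.comapIso j).inv

/-- Centres over `T` restrict to centres over `j⁻¹ T`. [folklore] -/
theorem CentresOver.restrict : ∀ {X U : Scheme.{u}} (s : CentreSeq X) (j : U ⟶ X)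
    [IsOpenImmersion j] {T : Set X}, s.CentresOver T → (s.restrict j).CentresOver (j ⁻¹' T)
  | _, _, nil _, _, _, _, _ => trivial
  | _, U, cons C rest, j, _, T, h => by
    obtain ⟨hC, hrest⟩ := h
    refine (centresOver_cons (C.comap j) _ _).mpr ⟨?_, ?_⟩
    · intro u hu
      rw [Scheme.IdealSheafData.support_comap] at hu
      exact hC hu
    · have := CentresOver.restrict rest (blowup.map C j) hrest
      have e : blowup.map C j ⁻¹' (blowup.π C ⁻¹' T) = blowup.π (C.comap j) ⁻¹' (j ⁻¹' T) := by
        rw [← Set.preimage_comp, ← Set.preimage_comp, ← TopCat.coe_comp, ← TopCat.coe_comp,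
          ← Scheme.Hom.comp_base, ← Scheme.Hom.comp_base, blowup.map_π]
      rwa [e] at this

/-- Strict transforms restrict to strict transforms: the strict transform of `j⁻¹ Y` along `s|U`
is the preimage of the strict transform of `Y` along `s` (closures commute with preimages under
open immersions). [folklore] -/
theorem restrict_strictTransform : ∀ {X U : Scheme.{u}} (s : CentreSeq X) (j : U ⟶ X)
    [IsOpenImmersion j] (Y : Set X),
    (s.restrict j).strictTransform (j ⁻¹' Y) = s.restrictι j ⁻¹' s.strictTransform Y
  | _, _, nil _, _, _, _ => rfl
  | _, U, cons C rest, j, _, Y => by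
    show (rest.restrict (blowup.map C j)).strictTransform
        (closure (blowup.π (C.comap j) ⁻¹' ((j ⁻¹' Y) \ ((C.comap j).support : Set U)))) =
      restrictι rest (blowup.map C j) ⁻¹'
        rest.strictTransform (closure (blowup.π C ⁻¹' (Y \ (C.support : Set _))))
    rw [← restrict_strictTransform rest (blowup.map C j)]
    congr 1
    rw [(blowup.map C j).isOpenEmbedding.isOpenMap.preimage_closure_eq_closure_preimage
      (blowup.map C j).continuous, ← Set.preimage_comp, ← TopCat.coe_comp, ← Scheme.Hom.comp_base,
      blowup.map_π, Scheme.Hom.comp_base, TopCat.coe_comp, Set.preimage_comp, Set.preimage_sdiff]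
    congr 2
    rw [Scheme.IdealSheafData.support_comap]
    rfl

end CentreSeq

/-! ## Multiple blow-ups of marked ideals as data (BGMW Defs. 3.1.3–3.1.4) -/

/-- Multiple blow-ups of marked ideals (`IsMultipleBlowup`, generated by appending blow-ups) are
closed under PREPENDING an admissible blow-up. [folklore] -/
theorem IsMultipleBlowup.precomp {X X₁ : Scheme.{u}} (M : MarkedIdeal X) (C : X.IdealSheafData)
    (τ : X₁ ⟶ X) (hτ : IsBlowup τ C) (hC : Scheme.IsRegular C.subscheme)
    (hsupp : (C.support : Set X) ⊆ M.support) (hsnc : HasSNCWith M.boundary C)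
    {X' : Scheme.{u}} {σ : X' ⟶ X₁} {M' : MarkedIdeal X'}
    (h : IsMultipleBlowup (M.transform τ C) σ M') : IsMultipleBlowup M (σ ≫ τ) M' := by
  induction h with
  | refl => simpa using IsMultipleBlowup.single M C τ hτ hC hsupp hsnc
  | @blowup X' X'' σ M' h C' τ' hτ' hC' hsupp' hsnc' ih =>
    simpa [Category.assoc] using IsMultipleBlowup.blowup ih C' τ' hτ' hC' hsupp' hsnc'

/-- For `μ ≥ 1`, `supp(𝓘, μ) ⊆ supp(𝓘, 1) = V(𝓘)` (BGMW Remark (2) after Def. 3.1.2).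
[cite: BierstoneGrigorievMilmanWlodarczyk2011, §3.1 Remark (2)] -/
theorem MarkedIdeal.support_subset_support_ideal {X : Scheme.{u}} (M : MarkedIdeal X)
    (h : 1 ≤ M.mult) : M.support ⊆ (M.ideal.support : Set X) := by
  intro x hx
  rw [MarkedIdeal.mem_support_iff] at hx
  rw [SetLike.mem_coe, mem_support_iff_stalkIdeal_le]
  exact hx.trans (Ideal.pow_le_self (by omega))

namespace CentreSeq

variable {X : Scheme.{u}}

/-- The transform `(X_r, 𝓘_r, E_r, μ)` of a marked ideal along a multiple blow-up (BGMW
Def. 3.1.3 (3)–(5) iterated: `MarkedIdeal.transform` at each step).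
[cite: BierstoneGrigorievMilmanWlodarczyk2011, Def. 3.1.3 (3)–(5)] -/
def transformMarked : {X : Scheme.{u}} → (s : CentreSeq X) → MarkedIdeal X → MarkedIdeal s.top
  | _, nil _, M => M
  | _, cons C rest, M => rest.transformMarked (M.transform (blowup.π C) C)

/-- **The sequence is a multiple blow-up of the marked ideal `M = (X, 𝓘, E, μ)`** (BGMW
Def. 3.1.3 (1)–(2) with Def. 3.1.4): each centre is a regular scheme [printed: smooth], lies in
the support `supp(𝓘_i, μ)` of the current transform (1) and has simple normal crossings with its
boundary `E_i` (2). [cite: BierstoneGrigorievMilmanWlodarczyk2011, Def. 3.1.3 (1)–(2)] -/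
def IsAdmissibleFor : {X : Scheme.{u}} → CentreSeq X → MarkedIdeal X → Prop
  | _, nil _, _ => True
  | _, cons C rest, M => (C.support : Set _) ⊆ M.support ∧ HasSNCWith M.boundary C ∧
      Scheme.IsRegular C.subscheme ∧ rest.IsAdmissibleFor (M.transform (blowup.π C) C)

/-- **The sequence is a resolution of the marked ideal `M`** (BGMW Def. 3.1.3: a multiple
blow-up of `M` with `supp(X_r, 𝓘_r, E_r, μ) = ∅` (6)).
[cite: BierstoneGrigorievMilmanWlodarczyk2011, Def. 3.1.3] -/
def IsResolutionOf {X : Scheme.{u}} (s : CentreSeq X) (M : MarkedIdeal X) : Prop :=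
  s.IsAdmissibleFor M ∧ (s.transformMarked M).support = ∅

/-- Unfolding. [folklore] -/
@[simp] theorem transformMarked_nil (M : MarkedIdeal X) : (nil X).transformMarked M = M := rfl
/-- Unfolding. [folklore] -/
@[simp] theorem transformMarked_cons (C : X.IdealSheafData) (rest : CentreSeq (blowup C))
    (M : MarkedIdeal X) :
    (cons C rest).transformMarked M = rest.transformMarked (M.transform (blowup.π C) C) := rfl
/-- Unfolding. [folklore] -/
@[simp] theorem isAdmissibleFor_nil (M : MarkedIdeal X) : (nil X).IsAdmissibleFor M := trivial
/-- Unfolding. [folklore] -/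
@[simp] theorem isAdmissibleFor_cons (C : X.IdealSheafData) (rest : CentreSeq (blowup C))
    (M : MarkedIdeal X) :
    (cons C rest).IsAdmissibleFor M ↔ (C.support : Set X) ⊆ M.support ∧ HasSNCWith M.boundary C ∧
      Scheme.IsRegular C.subscheme ∧ rest.IsAdmissibleFor (M.transform (blowup.π C) C) :=
  Iff.rfl


/-- The empty sequence resolves `M` iff `supp M = ∅` (non-vacuity of `IsResolutionOf`).
[folklore] -/
theorem isResolutionOf_nil_iff (M : MarkedIdeal X) : (nil X).IsResolutionOf M ↔ M.support = ∅ :=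
  ⟨fun h => h.2, fun h => ⟨trivial, h⟩⟩

/-- The multiplicity is unchanged along a sequence. [folklore] -/
theorem transformMarked_mult : ∀ {X : Scheme.{u}} (s : CentreSeq X) (M : MarkedIdeal X),
    (s.transformMarked M).mult = M.mult
  | _, nil _, _ => rfl
  | _, cons _ rest, _ => transformMarked_mult rest _

/-- A multiple blow-up of a marked ideal has regular centres. [folklore] -/
theorem IsAdmissibleFor.allRegular : ∀ {X : Scheme.{u}} (s : CentreSeq X) (M : MarkedIdeal X),
    s.IsAdmissibleFor M → s.AllRegular
  | _, nil _, _, _ => trivial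
  | _, cons C rest, M, h => by
    obtain ⟨-, -, hC, hrest⟩ := h
    exact (allRegular_cons C rest).mpr ⟨hC, IsAdmissibleFor.allRegular rest _ hrest⟩

/-- **The centres of a multiple blow-up of `(X, 𝓘, E, μ)`, `μ ≥ 1`, lie over `V(𝓘)`**:
`C_i ⊆ supp(𝓘_i, μ) ⊆ V(𝓘_i)` and `𝓘_i ⊇ σ^*𝓘` (the controlled transform contains the total
transform, `comap_le_controlledTransform`), so `V(𝓘_i) ⊆ σ⁻¹ V(𝓘)`. [folklore] -/
theorem IsAdmissibleFor.centresOver : ∀ {X : Scheme.{u}} (s : CentreSeq X) (M : MarkedIdeal X),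
    s.IsAdmissibleFor M → 1 ≤ M.mult → s.CentresOver (M.ideal.support : Set X)
  | _, nil _, _, _, _ => trivial
  | _, cons C rest, M, h, hμ => by
    obtain ⟨hC, -, -, hrest⟩ := h
    refine (centresOver_cons C rest _).mpr ⟨hC.trans (M.support_subset_support_ideal hμ), ?_⟩
    have ih := IsAdmissibleFor.centresOver rest _ hrest (by simpa using hμ)
    refine CentresOver.mono rest ?_ ih
    intro x hx
    have hle : M.ideal.comap (blowup.π C) ≤ (M.transform (blowup.π C) C).ideal :=
      comap_le_controlledTransform (blowup.π C) C M.ideal M.mult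
    have := Scheme.IdealSheafData.support_antitone hle hx
    rwa [Scheme.IdealSheafData.support_comap] at this

/-- A data-level multiple blow-up of `M` is a multiple blow-up in the sense of `MarkedIdeals.lean`
(`IsMultipleBlowup M σ M_r`). [cite: BierstoneGrigorievMilmanWlodarczyk2011, Def. 3.1.4] -/
theorem IsAdmissibleFor.isMultipleBlowup : ∀ {X : Scheme.{u}} (s : CentreSeq X) (M : MarkedIdeal X),
    s.IsAdmissibleFor M → IsMultipleBlowup M s.comp (s.transformMarked M)
  | _, nil _, M, _ => IsMultipleBlowup.refl M
  | _, cons C rest, M, h => by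
    obtain ⟨hsupp, hsnc, hC, hrest⟩ := h
    exact IsMultipleBlowup.precomp M C (blowup.π C) (blowup.isBlowup C) hC hsupp hsnc
      (IsAdmissibleFor.isMultipleBlowup rest _ hrest)

/-- A data-level resolution of `M` is a resolution in the sense of `MarkedIdeals.lean`
(`IsMarkedResolution`). [cite: BierstoneGrigorievMilmanWlodarczyk2011, Def. 3.1.3] -/
theorem IsResolutionOf.isMarkedResolution {s : CentreSeq X} {M : MarkedIdeal X}
    (h : s.IsResolutionOf M) : IsMarkedResolution M s.comp (s.transformMarked M) :=
  ⟨IsAdmissibleFor.isMultipleBlowup s M h.1, h.2⟩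

end CentreSeq

end Literature.AlgebraicGeometry.Resolution

end
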